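import Mathlib
import Summits.Ventures.YMGap.FlowData.RitzDeflationCertificate

/-!
# Venture YMGap, track Y3 FLOW-DATA — block eigenvalue certificates the KERNEL can replay (integer residual form)

HONEST FRAMING: venture file of the cell `pub-ymgap` (QuantumFields programme), track Y3; certification seat cert-1.
Pure finite-dimensional linear algebra: NO lattice object, no number of the table, nothing about limits or a mass gap.

Every Y3 transfer-matrix block certificate of record (lineage A `sntm`, A-onesite / A-t211, lineage C, cert-1's
`certify_block`) has the same three steps — an a-posteriori Cholesky RESIDUAL test for positive semidefiniteness, a
DEFLATION (rank-`k` shift) for the upper bounds of the top eigenvalues, and RAYLEIGH–RITZ trial vectors for their lower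
bounds — and each step is a typed door of the tree (`RitzDeflation.posSemidef_of_shifted_factor_residual`,
`RitzDeflation.eigenvalues₀_le_of_deflation_posSemidef`, `RitzDeflation.le_eigenvalues₀_of_ritz_posSemidef`).  What the
doors do NOT check is the ARITHMETIC: that the residual of a given factor really is small, that a given Gram matrix really
is positive definite.  In every lineage that arithmetic is done by code (interval / exact rational), outside the kernel.

This file restates the three doors with hypotheses that are DECIDABLE INTEGER INEQUALITIES over `Fin n` — finite sums of
products of integers compared with an integer — so that, for an explicitly given integer matrix `a : Fin n → Fin n → ℤ`
(an engine's exported block after integer symmetrisation `A = round(2^s M) + round(2^s Mᵀ)`), an integer Cholesky-type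
factor `r`, integer deflation / trial vectors and integer margins, `decide` (kernel evaluation) discharges the hypotheses
and the conclusion is an enclosure of Mathlib's sorted eigenvalues `Matrix.IsHermitian.eigenvalues₀` of the real matrix
`Matrix.of fun i j => (a i j : ℝ)`:

* `posSemidef_of_intResidual` — `c` symmetric, `Σ_j |c i j − δ·[i = j] − Σ_l r l i · r l j| ≤ δ` for every row `i`
  ⇒ `(c : ℝ-matrix) ⪰ 0` (the residual `Δ = C − δ·1 − RᵀR` has `‖Δ‖_∞ ≤ δ`, so `C = RᵀR + δ·1 + Δ ⪰ 0`);
* `eigenvalues₀_le_of_intDeflation` — the same test on `c = q²·(μ·1 − a) + Σ_{l<k} T_l · w_l w_lᵀ` (integers `q ≥ 1`,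
  `T_l ≥ 0`, integer vectors `w_l`) ⇒ `λ↓_i(a) ≤ μ` for every `i ≥ k`;
* `le_eigenvalues₀_of_intRayleigh` (`k = 1`) and `le_eigenvalues₀_of_intRitzTwo` (`k = 2`) — integer trial vectors with the
  `1×1` / `2×2` Gram and projected matrices tested by their entries (`Σ_i v_i² > 0`, `σ·Σ v_i² ≤ Σ_{ij} v_i a_ij v_j`; for two
  vectors the principal minors of `VᵀV` and of `VᵀaV − σ·VᵀV`) ⇒ `σ ≤ λ↓_0(a)` resp. `σ ≤ λ↓_i(a)` for `i < 2`;
* `posDef_fin_one` / `posSemidef_fin_one` / `posDef_fin_two` / `posSemidef_fin_two` — the `1×1` and `2×2` entry tests.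

A replayed certificate therefore reads: «for THIS integer matrix (printed in the file; sha256 of its canonical JSON in the
docstring) the kernel has checked `σ₀ ≤ λ↓₀ ≤ μ₀`, …» — the arithmetic leg of the certificate is no longer a code run.  What
remains outside the kernel is unchanged and stated where it is used: that the printed integers ARE the engine's exported
block (a manifest / sha fact), the producer's declared radius between its float block and the exact Galerkin matrix, and
the kept-set / character tails (typed elsewhere: `KWeightTail`, `TruncatedProductBound`).

References: S. M. Rump, *Verification of positive definiteness*, BIT 46 (2006) Thm. 2.3 [cite: Rump2006, Thm 2.3];
R. A. Horn, C. R. Johnson, *Matrix Analysis*, 2nd ed. (2013), Cor. 4.3.9, Thm. 4.3.21 [cite: HornJohnson2013, Cor 4.3.9;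
Thm 4.3.21]; cell files `flow/cert-1/README.md` §1 (the (L)(U)(P) steps of `certify.py`) and `CERT-CHAIN-cert1.md` §A.
-/

open Matrix Finset
open scoped BigOperators

namespace Summit.Ventures.YMGap.FlowData.KernelCert

open Literature.Analysis.InnerProduct Summit.Ventures.YMGap.FlowData.RitzDeflation

variable {n : ℕ}

/-! ### §1 Hermitian real matrices from symmetric integer tables -/

/-- A symmetric integer table gives a Hermitian real matrix. [folklore] -/
theorem isHermitian_of_intSymm (a : Fin n → Fin n → ℤ) (hsym : ∀ i j, a i j = a j i) :
    (Matrix.of fun i j : Fin n => (a i j : ℝ)).IsHermitian := by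
  refine Matrix.IsHermitian.ext fun i j => ?_
  simp only [of_apply, star_trivial, hsym i j]

/-! ### §2 Positive semidefiniteness from an INTEGER residual test -/

/-- **Integer residual test ⇒ PSD.**  If the integer matrix `c` is symmetric and, for some integer matrix `r` and
natural number `δ`, every row of the exact residual `c − δ·1 − rᵀ r` has absolute row sum `≤ δ`, then the real matrix
`c` is positive semidefinite (`c = rᵀr + δ·1 + Δ` with `‖Δ‖₂ ≤ ‖Δ‖_∞ ≤ δ`).  The hypothesis is a decidable statement the
kernel evaluates on literals. [cite: Rump2006, Thm 2.3] -/
theorem posSemidef_of_intResidual (c r : Fin n → Fin n → ℤ) (δ : ℕ) (hsym : ∀ i j, c i j = c j i)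
    (hres : ∀ i, ∑ j, |c i j - (if i = j then (δ : ℤ) else 0) - ∑ l, r l i * r l j| ≤ δ) :
    (Matrix.of fun i j : Fin n => (c i j : ℝ)).PosSemidef := by
  set C : Matrix (Fin n) (Fin n) ℝ := Matrix.of fun i j => (c i j : ℝ) with hC
  set R : Matrix (Fin n) (Fin n) ℝ := Matrix.of fun l i => (r l i : ℝ) with hR
  have hCh : C.IsHermitian := isHermitian_of_intSymm c hsym
  -- the integer residual entry and its symmetry
  have hsw : ∀ i j, (c i j - (if i = j then (δ : ℤ) else 0) - ∑ l, r l i * r l j)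
      = (c j i - (if j = i then (δ : ℤ) else 0) - ∑ l, r l j * r l i) := by
    intro i j
    rw [hsym i j]
    have h1 : (if i = j then (δ : ℤ) else 0) = (if j = i then (δ : ℤ) else 0) := by
      by_cases h : i = j
      · subst h; rfl
      · rw [if_neg h, if_neg (Ne.symm h)]
    rw [h1, Finset.sum_congr rfl (fun l _ => mul_comm (r l i) (r l j))]
  have hentry : ∀ i j, (C - (δ : ℝ) • (1 : Matrix (Fin n) (Fin n) ℝ) - Rᴴ * R) i j
      = ((c i j - (if i = j then (δ : ℤ) else 0) - ∑ l, r l i * r l j : ℤ) : ℝ) := by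
    intro i j
    simp only [hC, hR, Matrix.sub_apply, Matrix.smul_apply, Matrix.one_apply, Matrix.mul_apply, conjTranspose_apply,
      of_apply, star_trivial, smul_eq_mul, mul_ite, mul_one, mul_zero]
    push_cast
    split_ifs <;> ring
  refine posSemidef_of_shifted_factor_residual hCh R
    (fun i j => ((|c i j - (if i = j then (δ : ℤ) else 0) - ∑ l, r l i * r l j| : ℤ) : ℝ))
    (δ := (δ : ℝ)) (r := (δ : ℝ)) (fun i j => ?_) (fun i => ?_) (fun j => ?_) le_rfl
  · -- domination: the norm of the residual entry IS the cast of the integer absolute value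
    have h := hentry i j
    simp only [RCLike.ofReal_real_eq_id, id_eq] at h ⊢
    rw [h, Real.norm_eq_abs, ← Int.cast_abs]
  · -- row sums
    exact_mod_cast hres i
  · -- column sums = row sums by symmetry
    have h : ∀ i, ((|c i j - (if i = j then (δ : ℤ) else 0) - ∑ l, r l i * r l j| : ℤ) : ℝ)
        = ((|c j i - (if j = i then (δ : ℤ) else 0) - ∑ l, r l j * r l i| : ℤ) : ℝ) := fun i => by rw [hsw i j]
    rw [Finset.sum_congr rfl (fun i _ => h i)]
    exact_mod_cast hres j

/-! ### §3 Upper bounds of the top eigenvalues: integer deflation certificate -/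

/-- **Integer deflation certificate ⇒ `λ↓_i ≤ μ` for `i ≥ k`.**  For a symmetric integer matrix `a`, integers `μ`,
`q ≥ 1`, natural weights `T_l` and integer vectors `w_l` (`l < k`), if the integer matrix
`c = q²·(μ·1 − a) + Σ_l T_l · w_l w_lᵀ` passes the residual test of `posSemidef_of_intResidual` with some integer factor
`r` and margin `δ`, then every sorted eigenvalue `λ↓_i`, `i ≥ k`, of the real matrix `a` is `≤ μ`
(`μ·1 − a + Σ_l (T_l/q²) · w_l w_lᵀ ⪰ 0` and the tree's deflation door). [cite: HornJohnson2013, Cor 4.3.9] -/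
theorem eigenvalues₀_le_of_intDeflation (a : Fin n → Fin n → ℤ) {k : ℕ} (w : Fin k → Fin n → ℤ) (T : Fin k → ℕ)
    (μ : ℤ) (q : ℕ) (hq : 0 < q) (r : Fin n → Fin n → ℤ) (δ : ℕ) (hsym : ∀ i j, a i j = a j i)
    (hres : ∀ i, ∑ j, |((q : ℤ) ^ 2 * ((if i = j then μ else 0) - a i j) + ∑ l, (T l : ℤ) * w l i * w l j)
        - (if i = j then (δ : ℤ) else 0) - ∑ l, r l i * r l j| ≤ δ)
    (hA : (Matrix.of fun i j : Fin n => (a i j : ℝ)).IsHermitian)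
    (i : Fin (Fintype.card (Fin n))) (hi : k ≤ (i : ℕ)) : hA.eigenvalues₀ i ≤ (μ : ℝ) := by
  set c : Fin n → Fin n → ℤ := fun i j =>
    (q : ℤ) ^ 2 * ((if i = j then μ else 0) - a i j) + ∑ l, (T l : ℤ) * w l i * w l j with hc
  have hcsym : ∀ i j, c i j = c j i := by
    intro i j
    simp only [hc]
    rw [hsym i j]
    have h1 : (if i = j then μ else 0) = (if j = i then μ else 0) := by
      by_cases h : i = j
      · subst h; rfl
      · rw [if_neg h, if_neg (Ne.symm h)]
    rw [h1, Finset.sum_congr rfl (fun l _ => by ring : ∀ l ∈ univ, (T l : ℤ) * w l i * w l j = (T l : ℤ) * w l j * w l i)]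
  have hpsd := posSemidef_of_intResidual c r δ hcsym hres
  set A : Matrix (Fin n) (Fin n) ℝ := Matrix.of fun i j : Fin n => (a i j : ℝ) with hAdef
  have hq' : (0 : ℝ) < (q : ℝ) ^ 2 := by positivity
  -- the deflated shifted matrix, over ℝ
  set D : Matrix (Fin n) (Fin n) ℝ := (μ : ℝ) • (1 : Matrix (Fin n) (Fin n) ℝ) - A +
    ∑ l, ((T l : ℝ) / (q : ℝ) ^ 2) • vecMulVec (fun i => (w l i : ℝ)) (star fun i => (w l i : ℝ)) with hD
  have hmat : (Matrix.of fun i j : Fin n => (c i j : ℝ)) = ((q : ℝ) ^ 2) • D := by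
    ext i j
    have hsum : (q : ℝ) ^ 2 * ∑ l, (T l : ℝ) / (q : ℝ) ^ 2 * ((w l i : ℝ) * (w l j : ℝ))
        = ∑ l, ((T l : ℤ) * w l i * w l j : ℤ) := by
      push_cast
      rw [Finset.mul_sum]
      refine Finset.sum_congr rfl fun l _ => ?_
      field_simp
    simp only [hc, hD, hAdef, of_apply, Matrix.smul_apply, Matrix.sub_apply, Matrix.add_apply, Matrix.one_apply,
      Matrix.sum_apply, vecMulVec_apply, star_trivial, smul_eq_mul]
    rw [mul_add, hsum]
    push_cast
    split_ifs <;> ring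
  have hD' : D.PosSemidef := by
    have h1 : (((q : ℝ) ^ 2)⁻¹ • Matrix.of fun i j : Fin n => (c i j : ℝ)).PosSemidef :=
      hpsd.smul (inv_nonneg.mpr hq'.le)
    rwa [hmat, smul_smul, inv_mul_cancel₀ hq'.ne', one_smul] at h1
  refine eigenvalues₀_le_of_deflation_posSemidef hA (fun l i => (w l i : ℝ)) (fun l => (T l : ℝ) / (q : ℝ) ^ 2)
    (μ := (μ : ℝ)) ?_ i hi
  simpa only [RCLike.ofReal_real_eq_id, id_eq, hD] using hD'

/-! ### §4 Small Gram matrices by their entries -/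

/-- A `1×1` real matrix with positive entry is positive definite. [folklore] -/
theorem posDef_fin_one {S : Matrix (Fin 1) (Fin 1) ℝ} (h : 0 < S 0 0) : S.PosDef := by
  refine PosDef.of_dotProduct_mulVec_pos ?_ fun x hx => ?_
  · refine Matrix.IsHermitian.ext fun i j => ?_
    fin_cases i; fin_cases j; simp
  · have hx0 : x 0 ≠ 0 := by
      intro h0
      apply hx
      funext i
      fin_cases i
      exact h0
    simp only [dotProduct, mulVec, Fin.sum_univ_one, Pi.star_apply, star_trivial]
    have : 0 < x 0 * x 0 := mul_self_pos.mpr hx0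
    nlinarith

/-- A `1×1` real matrix with non-negative entry is positive semidefinite. [folklore] -/
theorem posSemidef_fin_one {S : Matrix (Fin 1) (Fin 1) ℝ} (h : 0 ≤ S 0 0) : S.PosSemidef := by
  refine PosSemidef.of_dotProduct_mulVec_nonneg ?_ fun x => ?_
  · refine Matrix.IsHermitian.ext fun i j => ?_
    fin_cases i; fin_cases j; simp
  · simp only [dotProduct, mulVec, Fin.sum_univ_one, Pi.star_apply, star_trivial]
    nlinarith [mul_self_nonneg (x 0)]

/-- A symmetric `2×2` real matrix with `S₀₀ > 0` and positive determinant is positive definite. [folklore] -/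
theorem posDef_fin_two {S : Matrix (Fin 2) (Fin 2) ℝ} (hs : S 0 1 = S 1 0) (h0 : 0 < S 0 0)
    (hdet : S 0 1 * S 1 0 < S 0 0 * S 1 1) : S.PosDef := by
  refine PosDef.of_dotProduct_mulVec_pos ?_ fun x hx => ?_
  · refine Matrix.IsHermitian.ext fun i j => ?_
    fin_cases i <;> fin_cases j <;> simp [hs]
  · simp only [dotProduct, mulVec, Fin.sum_univ_two, Pi.star_apply, star_trivial]
    rw [hs] at hdet ⊢
    have hne : x 0 ≠ 0 ∨ x 1 ≠ 0 := by
      by_contra hc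
      push Not at hc
      apply hx
      funext i
      fin_cases i
      · exact hc.1
      · exact hc.2
    -- `S₀₀ · xᵀSx = (S₀₀ x₀ + S₁₀ x₁)² + (S₀₀ S₁₁ − S₁₀²) x₁²`
    have key : S 0 0 * (x 0 * (S 0 0 * x 0 + S 1 0 * x 1) + x 1 * (S 1 0 * x 0 + S 1 1 * x 1))
        = (S 0 0 * x 0 + S 1 0 * x 1) ^ 2 + (S 0 0 * S 1 1 - S 1 0 * S 1 0) * x 1 ^ 2 := by ring
    rcases hne with h | h
    · by_cases h1 : x 1 = 0
      · have : 0 < x 0 * x 0 := mul_self_pos.mpr h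
        rw [h1]
        nlinarith
      · have hx1 : 0 < x 1 ^ 2 := by positivity
        have hpos : 0 < S 0 0 * (x 0 * (S 0 0 * x 0 + S 1 0 * x 1) + x 1 * (S 1 0 * x 0 + S 1 1 * x 1)) := by
          rw [key]; nlinarith [sq_nonneg (S 0 0 * x 0 + S 1 0 * x 1)]
        exact pos_of_mul_pos_right hpos h0.le
    · have hx1 : 0 < x 1 ^ 2 := by positivity
      have hpos : 0 < S 0 0 * (x 0 * (S 0 0 * x 0 + S 1 0 * x 1) + x 1 * (S 1 0 * x 0 + S 1 1 * x 1)) := by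
        rw [key]; nlinarith [sq_nonneg (S 0 0 * x 0 + S 1 0 * x 1)]
      exact pos_of_mul_pos_right hpos h0.le

/-- A symmetric `2×2` real matrix with non-negative diagonal and non-negative determinant is positive
semidefinite. [folklore] -/
theorem posSemidef_fin_two {S : Matrix (Fin 2) (Fin 2) ℝ} (hs : S 0 1 = S 1 0) (h0 : 0 ≤ S 0 0) (h1 : 0 ≤ S 1 1)
    (hdet : S 0 1 * S 1 0 ≤ S 0 0 * S 1 1) : S.PosSemidef := by
  refine PosSemidef.of_dotProduct_mulVec_nonneg ?_ fun x => ?_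
  · refine Matrix.IsHermitian.ext fun i j => ?_
    fin_cases i <;> fin_cases j <;> simp [hs]
  · simp only [dotProduct, mulVec, Fin.sum_univ_two, Pi.star_apply, star_trivial]
    rw [hs] at hdet ⊢
    have key : S 0 0 * (x 0 * (S 0 0 * x 0 + S 1 0 * x 1) + x 1 * (S 1 0 * x 0 + S 1 1 * x 1))
        = (S 0 0 * x 0 + S 1 0 * x 1) ^ 2 + (S 0 0 * S 1 1 - S 1 0 * S 1 0) * x 1 ^ 2 := by ring
    rcases h0.lt_or_eq with hpos | hzero
    · have hnn : 0 ≤ S 0 0 * (x 0 * (S 0 0 * x 0 + S 1 0 * x 1) + x 1 * (S 1 0 * x 0 + S 1 1 * x 1)) := by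
        rw [key]; nlinarith [sq_nonneg (S 0 0 * x 0 + S 1 0 * x 1), sq_nonneg (x 1)]
      exact nonneg_of_mul_nonneg_right hnn hpos |> fun h => by nlinarith [h, hnn, hpos]
    · -- `S₀₀ = 0` forces `S₁₀ = 0`
      have hb : S 1 0 = 0 := by
        have : S 1 0 * S 1 0 ≤ 0 := by rw [← hzero] at hdet; simpa using hdet
        nlinarith [mul_self_nonneg (S 1 0)]
      rw [← hzero, hb]
      nlinarith [mul_self_nonneg (x 1)]

/-! ### §5 Lower bounds of the top eigenvalues: integer Rayleigh–Ritz certificates -/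

/-- **One integer trial vector ⇒ `σ ≤ λ↓₀`.**  `Σ v_i² > 0` and `σ · Σ v_i² ≤ Σ_{ij} v_i a_ij v_j` (integers) give
`σ ≤ λ↓_i(a)` for `i < 1`, i.e. for the largest eigenvalue (Rayleigh quotient; the tree's Rayleigh–Ritz door with one
column). [cite: HornJohnson2013, Thm 4.3.21] -/
theorem le_eigenvalues₀_of_intRayleigh (a : Fin n → Fin n → ℤ) (v : Fin n → ℤ) (σ : ℤ)
    (hpos : 0 < ∑ i, v i * v i) (hrq : σ * ∑ i, v i * v i ≤ ∑ i, ∑ j, v i * a i j * v j)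
    (hA : (Matrix.of fun i j : Fin n => (a i j : ℝ)).IsHermitian)
    (i : Fin (Fintype.card (Fin n))) (hi : (i : ℕ) < 1) : (σ : ℝ) ≤ hA.eigenvalues₀ i := by
  set A : Matrix (Fin n) (Fin n) ℝ := Matrix.of fun i j : Fin n => (a i j : ℝ) with hAdef
  set W : Matrix (Fin n) (Fin 1) ℝ := Matrix.of fun i _ => (v i : ℝ) with hW
  have hG00 : (Wᴴ * W) 0 0 = ((∑ i, v i * v i : ℤ) : ℝ) := by
    simp only [hW, Matrix.mul_apply, conjTranspose_apply, of_apply, star_trivial]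
    push_cast
    rfl
  have hWAW : (Wᴴ * A * W) 0 0 = ((∑ i, ∑ j, v i * a i j * v j : ℤ) : ℝ) := by
    simp only [hW, hAdef, Matrix.mul_apply, conjTranspose_apply, of_apply, star_trivial, Finset.sum_mul]
    push_cast
    rw [Finset.sum_comm]
  have hH00 : (Wᴴ * A * W - (σ : ℝ) • (Wᴴ * W)) 0 0 = ((∑ i, ∑ j, v i * a i j * v j : ℤ) - σ * ∑ i, v i * v i : ℝ) := by
    rw [Matrix.sub_apply, Matrix.smul_apply, smul_eq_mul, hWAW, hG00]
  have hG : (Wᴴ * W).PosDef := posDef_fin_one (by rw [hG00]; exact_mod_cast hpos)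
  have hH : (Wᴴ * A * W - (σ : ℝ) • (Wᴴ * W)).PosSemidef :=
    posSemidef_fin_one (by rw [hH00]; exact_mod_cast sub_nonneg.mpr hrq)
  refine le_eigenvalues₀_of_ritz_posSemidef hA W hG (σ := (σ : ℝ)) ?_ i ?_
  · simpa only [RCLike.ofReal_real_eq_id, id_eq] using hH
  · simp only [Fintype.card_fin]; omega

/-- **Two integer trial vectors ⇒ `σ ≤ λ↓₁`.**  With `s_pq = Σ_i v_p i · v_q i` and
`h_pq = Σ_{ij} v_p i · a_ij · v_q j` (integers): if `s₀₀ > 0`, `s₀₀ s₁₁ > s₀₁²` (the Gram matrix of `v₀, v₁` is positive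
definite) and `h₀₀ − σ s₀₀ ≥ 0`, `h₁₁ − σ s₁₁ ≥ 0`, `(h₀₀ − σ s₀₀)(h₁₁ − σ s₁₁) ≥ (h₀₁ − σ s₀₁)²`, then `σ ≤ λ↓_i(a)` for
`i < 2` (Rayleigh–Ritz on the span of `v₀, v₁`). [cite: HornJohnson2013, Thm 4.3.21] -/
theorem le_eigenvalues₀_of_intRitzTwo (a : Fin n → Fin n → ℤ) (v₀ v₁ : Fin n → ℤ) (σ : ℤ)
    (hsym : ∀ i j, a i j = a j i)
    (hs0 : 0 < ∑ i, v₀ i * v₀ i)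
    (hsdet : (∑ i, v₀ i * v₁ i) * (∑ i, v₀ i * v₁ i) < (∑ i, v₀ i * v₀ i) * (∑ i, v₁ i * v₁ i))
    (hh0 : 0 ≤ (∑ i, ∑ j, v₀ i * a i j * v₀ j) - σ * ∑ i, v₀ i * v₀ i)
    (hh1 : 0 ≤ (∑ i, ∑ j, v₁ i * a i j * v₁ j) - σ * ∑ i, v₁ i * v₁ i)
    (hhdet : ((∑ i, ∑ j, v₀ i * a i j * v₁ j) - σ * ∑ i, v₀ i * v₁ i)
        * ((∑ i, ∑ j, v₀ i * a i j * v₁ j) - σ * ∑ i, v₀ i * v₁ i)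
        ≤ ((∑ i, ∑ j, v₀ i * a i j * v₀ j) - σ * ∑ i, v₀ i * v₀ i)
          * ((∑ i, ∑ j, v₁ i * a i j * v₁ j) - σ * ∑ i, v₁ i * v₁ i))
    (hA : (Matrix.of fun i j : Fin n => (a i j : ℝ)).IsHermitian)
    (i : Fin (Fintype.card (Fin n))) (hi : (i : ℕ) < 2) : (σ : ℝ) ≤ hA.eigenvalues₀ i := by
  set A : Matrix (Fin n) (Fin n) ℝ := Matrix.of fun i j : Fin n => (a i j : ℝ) with hAdef
  set W : Matrix (Fin n) (Fin 2) ℝ := Matrix.of fun i p => ((![v₀, v₁] p i : ℤ) : ℝ) with hW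
  -- entries of the Gram matrix and of the projected shifted matrix, as casts of the integer sums
  have hG : ∀ p q : Fin 2, (Wᴴ * W) p q = ((∑ i, ![v₀, v₁] p i * ![v₀, v₁] q i : ℤ) : ℝ) := by
    intro p q
    simp only [hW, Matrix.mul_apply, conjTranspose_apply, of_apply, star_trivial]
    push_cast
    rfl
  have hWAW : ∀ p q : Fin 2, (Wᴴ * A * W) p q = ((∑ i, ∑ j, ![v₀, v₁] p i * a i j * ![v₀, v₁] q j : ℤ) : ℝ) := by
    intro p q
    simp only [hW, hAdef, Matrix.mul_apply, conjTranspose_apply, of_apply, star_trivial, Finset.sum_mul]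
    push_cast
    rw [Finset.sum_comm]
  have hH : ∀ p q : Fin 2, (Wᴴ * A * W - (σ : ℝ) • (Wᴴ * W)) p q
      = (((∑ i, ∑ j, ![v₀, v₁] p i * a i j * ![v₀, v₁] q j : ℤ) - σ * ∑ i, ![v₀, v₁] p i * ![v₀, v₁] q i : ℤ) : ℝ) := by
    intro p q
    rw [Matrix.sub_apply, Matrix.smul_apply, smul_eq_mul, hWAW, hG]
    push_cast
    ring
  -- symmetry of the mixed projected entry (`a` symmetric)
  have hmix : (∑ i, ∑ j, v₁ i * a i j * v₀ j) = ∑ i, ∑ j, v₀ i * a i j * v₁ j := by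
    rw [Finset.sum_comm]
    refine Finset.sum_congr rfl fun i _ => Finset.sum_congr rfl fun j _ => ?_
    rw [hsym j i]; ring
  have hsmix : (∑ i, v₁ i * v₀ i) = ∑ i, v₀ i * v₁ i := Finset.sum_congr rfl fun i _ => mul_comm _ _
  have hGpd : (Wᴴ * W).PosDef := by
    refine posDef_fin_two ?_ ?_ ?_
    · rw [hG, hG]; simp only [Matrix.cons_val_zero, Matrix.cons_val_one]; exact_mod_cast hsmix.symm
    · rw [hG]; simp only [Matrix.cons_val_zero]; exact_mod_cast hs0
    · rw [hG, hG, hG, hG]; simp only [Matrix.cons_val_zero, Matrix.cons_val_one]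
      rw [hsmix]; exact_mod_cast hsdet
  have hHpsd : (Wᴴ * A * W - (σ : ℝ) • (Wᴴ * W)).PosSemidef := by
    refine posSemidef_fin_two ?_ ?_ ?_ ?_
    · rw [hH, hH]; simp only [Matrix.cons_val_zero, Matrix.cons_val_one]; rw [hmix, hsmix]
    · rw [hH]; simp only [Matrix.cons_val_zero]; exact_mod_cast hh0
    · rw [hH]; simp only [Matrix.cons_val_one]; exact_mod_cast hh1
    · rw [hH, hH, hH, hH]; simp only [Matrix.cons_val_zero, Matrix.cons_val_one]
      rw [hmix, hsmix]; exact_mod_cast hhdet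
  refine le_eigenvalues₀_of_ritz_posSemidef hA W hGpd (σ := (σ : ℝ)) ?_ i ?_
  · simpa only [RCLike.ofReal_real_eq_id, id_eq] using hHpsd
  · simp only [Fintype.card_fin]; omega

end Summit.Ventures.YMGap.FlowData.KernelCert
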